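import Summits.RiemannHypothesis.Statement
import Literature.StrongHypotheses.RiemannHypothesis
import Literature.NumberTheory.LFunctions.RHWave0GRHProofs
import Literature.NumberTheory.LFunctions.DedekindZetaERHProofs
import Literature.NumberTheory.LFunctions.SelbergClassRiemannZetaProofs
import Literature.NumberTheory.LFunctions.AutomorphicGRHProofs
import Literature.NumberTheory.LFunctions.NymanBeurling
import Literature.NumberTheory.LFunctions.RiemannXiProofs
import Literature.NumberTheory.LFunctions.DeBruijnNewmanConstProofs
import Literature.NumberTheory.LFunctions.RHClassicalEquivalentsRobinProofs
import Literature.NumberTheory.LFunctions.RHClassicalEquivalentsVonKochProofs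
import Literature.NumberTheory.LFunctions.RHClassicalEquivalentsSpeiserProofs
import Literature.NumberTheory.LFunctions.RHClassicalEquivalentsProofs
import Literature.NumberTheory.LFunctions.MertensBoundRH
import Literature.NumberTheory.LFunctions.EquivalentsKeiperLiProofs
import Literature.NumberTheory.LFunctions.NymanBeurlingBaezDuarteProofs
import Literature.NumberTheory.LFunctions.XiMultiplePositivityProofs
import Literature.NumberTheory.LFunctions.WeilCriterionProofs
import Literature.NumberTheory.LFunctions.JensenPolyaProofs
import HarnessLib
import HarnessLib.Audit.TribunalTags

/-!
# Summit `RiemannHypothesis` — bridges of the Strong-Hypothesis Library (D-0034)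

Summit-side BRIDGE file for the registry `Literature/StrongHypotheses/RiemannHypothesis.lean`: for every
`H` tagged there with `@[strong_hypothesis "RiemannHypothesis.RiemannHypothesis"]`, exactly ONE bridge
tagged `@[summit_bridge "RiemannHypothesis.RiemannHypothesis"]`, concluding the problem statement. The
problem `Summit.RiemannHypothesis` (`Summits/RiemannHypothesis/RiemannHypothesis/Statement.lean`) is BY
DEFINITION Mathlib's `_root_.RiemannHypothesis` (`Summit.RiemannHypothesis_iff : … ↔ … := Iff.rfl`); every
bridge below concludes `_root_.RiemannHypothesis`, written with the `_root_` prefix because inside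
`namespace Summit.…` the bare identifier would resolve to the (definitionally equal) summit `def`.

* LANDED bridges (21): a `theorem H → RiemannHypothesis` (strictly stronger `H`) or
  `theorem H ↔ RiemannHypothesis` (equivalent criterion), each a one-line application of a theorem already
  proved in `Literature/NumberTheory/LFunctions/…Proofs.lean` (named in the docstring). For the criteria
  whose hypothesis side is a NEW `def` of the registry file, that `def` is verbatim the right-hand side of the
  tree's `… ↔ …` named fact, so the landed `_holds` theorem is the bridge up to `Iff.symm` and unfolding.
* PRINTED bridge (1): `WeakMertensHypothesisImpliesRiemannHypothesis` (Titchmarsh §14.29), a NAMED FACT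
  (CONVENTIONS §4) to be discharged by a literature-prover as
  `theorem WeakMertensHypothesisImpliesRiemannHypothesis_holds` in
  `Summits/RiemannHypothesis/RiemannHypothesis/Theorems/StrongHypothesesWeakMertensHypothesisBridge.lean`.

No new mathematics is proved here; no `sorry`, no axiom; imports are the `…Proofs` modules holding the
discharges (all previously landed).
-/

noncomputable section

namespace Summit.RiemannHypothesis.StrongHypotheses

open Literature.NumberTheory.LFunctions
open Literature.StrongHypotheses.RiemannHypothesis

/-! ## Strictly stronger hypotheses -/

/-- **GRH ⇒ RH** (landed): the modulus-`1` Dirichlet `L`-function is `ζ`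
(`GeneralizedRiemannHypothesis.riemannHypothesis`, `RHWave0GRHProofs`; Davenport ch. 20). [folklore] -/
@[summit_bridge "RiemannHypothesis.RiemannHypothesis"]
theorem generalizedRiemannHypothesis_implies_riemannHypothesis :
    GeneralizedRiemannHypothesis → _root_.RiemannHypothesis :=
  fun h ↦ h.riemannHypothesis

/-- **ERH ⇒ RH** (landed): `ζ_ℚ = ζ` (`ExtendedRiemannHypothesis.riemannHypothesis_holds`,
`DedekindZetaERHProofs`; Iwaniec–Kowalski §5.10). [cite: IwaniecKowalski2004, §5.10] -/
@[summit_bridge "RiemannHypothesis.RiemannHypothesis"]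
theorem extendedRiemannHypothesis_implies_riemannHypothesis :
    ExtendedRiemannHypothesis → _root_.RiemannHypothesis :=
  fun h ↦ ExtendedRiemannHypothesis.riemannHypothesis_holds h

/-- **Grand RH for the Selberg class ⇒ RH** (landed): `ζ ∈ 𝒮`
(`SelbergGrandRiemannHypothesis.riemannHypothesis`, `SelbergClassRiemannZetaProofs`; Conrey–Ghosh 1993 §1).
[cite: ConreyGhosh1993, §1] -/
@[summit_bridge "RiemannHypothesis.RiemannHypothesis"]
theorem selbergGrandRiemannHypothesis_implies_riemannHypothesis :
    SelbergGrandRiemannHypothesis → _root_.RiemannHypothesis :=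
  fun h ↦ h.riemannHypothesis

/-- **Grand RH for cuspidal `GL_n/ℚ` ⇒ RH** (landed): the `n = 1` instance is GRH for Dirichlet
`L`-functions (`automorphicGRH_one_iff_generalizedRiemannHypothesis_holds`, `AutomorphicGRHProofs`; Tate 1950,
Iwaniec–Kowalski §5.7), and GRH ⇒ RH. [cite: IwaniecKowalski2004, §5.7] -/
@[summit_bridge "RiemannHypothesis.RiemannHypothesis"]
theorem grandRiemannHypothesisGL_implies_riemannHypothesis :
    GrandRiemannHypothesisGL → _root_.RiemannHypothesis :=
  fun h ↦ h.riemannHypothesis automorphicGRH_one_iff_generalizedRiemannHypothesis_holds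

/-- **`M(x) = O(√x)` ⇒ RH** (landed): Stieltjes's argument through Littlewood's criterion
(`Literature.Barriers.RiemannHypothesis.riemannHypothesis_of_mertensHypothesisBigO`, `MertensDisproof`;
Titchmarsh §14.28). [cite: Titchmarsh1986, §14.28] -/
@[summit_bridge "RiemannHypothesis.RiemannHypothesis"]
theorem mertensHypothesisBigO_implies_riemannHypothesis :
    Literature.Barriers.RiemannHypothesis.MertensHypothesisBigO → _root_.RiemannHypothesis :=
  Literature.Barriers.RiemannHypothesis.riemannHypothesis_of_mertensHypothesisBigO

/-- PRINTED bridge (NAMED FACT, CONVENTIONS §4): **the weak Mertens hypothesis implies RH.**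
Titchmarsh, *The Theory of the Riemann Zeta-Function*, §14.29: from
`1/ζ(s) = s ∫₁^∞ M(x) x^{-s-1} dx` (`σ > 1`) and (14.29.1) `∫₁^X (M(x)/x)² dx = O(log X)`, the
Cauchy–Schwarz inequality on dyadic blocks `[2^k, 2^{k+1}]` gives
`∫_{2^k}^{2^{k+1}} |M(x)| x^{-σ-1} dx ≪ 2^{k(1/2-σ)} √k`, so the integral converges absolutely and locally
uniformly for `σ > 1/2`; hence `1/ζ` continues analytically to `σ > 1/2`, i.e. `ζ(s) ≠ 0` there, which is RH
(`ZetaZeroFreeHalfPlane`, or directly `riemannHypothesis_of_mertensFunction_isBigO`-style continuation in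
`LittlewoodCriterion.lean`). Titchmarsh proves more (simple zeros, `∑ |ρ ζ'(ρ)|⁻² < ∞`), not recorded here.
To be discharged as `theorem WeakMertensHypothesisImpliesRiemannHypothesis_holds`.
[cite: Titchmarsh1986, §14.29 (first consequence of (14.29.1))] -/
@[summit_bridge "RiemannHypothesis.RiemannHypothesis"]
def WeakMertensHypothesisImpliesRiemannHypothesis : Prop :=
  WeakMertensHypothesis → _root_.RiemannHypothesis

/-! ## Equivalent reformulations (criteria), all landed -/

/-- **Strip form ↔ RH** (landed: `riemannHypothesis_iff_strip_holds`, `GeneralizedRH`; Davenport ch. 8).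
[cite: DavenportMNT1980, ch. 8] -/
@[summit_bridge "RiemannHypothesis.RiemannHypothesis"]
theorem riemannHypothesisStrip_iff_riemannHypothesis :
    RiemannHypothesisStrip ↔ _root_.RiemannHypothesis :=
  riemannHypothesis_iff_strip_holds.symm

/-- **`ζ ≠ 0` on `σ > 1/2` ↔ RH** (landed: `forall_riemannZeta_ne_zero_iff_quasiRiemannHypothesis (1/2)`,
`NymanBeurling`, composed with `quasiRiemannHypothesis_one_half_iff_holds`, `GeneralizedRH`; Davenport ch. 8).
[cite: DavenportMNT1980, ch. 8] -/
@[summit_bridge "RiemannHypothesis.RiemannHypothesis"]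
theorem zetaZeroFreeHalfPlane_iff_riemannHypothesis :
    ZetaZeroFreeHalfPlane ↔ _root_.RiemannHypothesis :=
  (forall_riemannZeta_ne_zero_iff_quasiRiemannHypothesis (1 / 2)).trans
    quasiRiemannHypothesis_one_half_iff_holds

/-- **All zeros of `Ξ` real ↔ RH** (landed: `riemannHypothesis_iff_im_eq_zero_of_riemannXiUpper_eq_zero_holds`,
`RiemannXiProofs`; Riemann 1859, Titchmarsh §10.1). [cite: Titchmarsh1986, §10.1] -/
@[summit_bridge "RiemannHypothesis.RiemannHypothesis"]
theorem xiHasOnlyRealZeros_iff_riemannHypothesis :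
    XiHasOnlyRealZeros ↔ _root_.RiemannHypothesis :=
  riemannHypothesis_iff_im_eq_zero_of_riemannXiUpper_eq_zero_holds.symm

/-- **`Λ ≤ 0` ↔ RH** (landed: `riemannHypothesis_iff_deBruijnNewmanConst_nonpos`, `DeBruijnNewmanConstProofs`;
Newman 1976 Thm. 3, Rodgers–Tao 2020 §1). [cite: NewmanPAMS1976, Thm. 3] -/
@[summit_bridge "RiemannHypothesis.RiemannHypothesis"]
theorem deBruijnNewmanLeZero_iff_riemannHypothesis :
    DeBruijnNewmanLeZero ↔ _root_.RiemannHypothesis :=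
  riemannHypothesis_iff_deBruijnNewmanConst_nonpos.symm

/-- **Robin's criterion** (landed: `robin_iff_holds`, `RHClassicalEquivalentsRobinProofs`; Robin 1984 Thm. 1).
[cite: Robin1984, Thm. 1] -/
@[summit_bridge "RiemannHypothesis.RiemannHypothesis"]
theorem robinHypothesis_iff_riemannHypothesis :
    RobinHypothesis ↔ _root_.RiemannHypothesis :=
  (robin_iff_iff.mp robin_iff_holds).symm

/-- **Lagarias's criterion** (landed: `lagarias_iff_holds`, `RHClassicalEquivalentsRobinProofs`;
Lagarias 2002 Thm. 1.1). [cite: Lagarias2002, Thm. 1.1] -/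
@[summit_bridge "RiemannHypothesis.RiemannHypothesis"]
theorem lagariasInequality_iff_riemannHypothesis :
    LagariasInequality ↔ _root_.RiemannHypothesis :=
  Iff.symm lagarias_iff_holds

/-- **Littlewood's criterion** (landed: `riemannHypothesis_iff_mertensFunction_isBigO_holds`, `MertensBoundRH`;
Littlewood 1912, Titchmarsh Thm. 14.25 (C)). [cite: Littlewood1912, Théorème (Titchmarsh Thm 14.25 C)] -/
@[summit_bridge "RiemannHypothesis.RiemannHypothesis"]
theorem mertensLittlewoodBound_iff_riemannHypothesis :
    MertensLittlewoodBound ↔ _root_.RiemannHypothesis :=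
  Iff.symm riemannHypothesis_iff_mertensFunction_isBigO_holds

/-- **von Koch's criterion (`ψ` form)** (landed: `riemannHypothesis_iff_chebyshevPsi_isBigO_holds`,
`RHClassicalEquivalentsVonKochProofs`; von Koch 1901, Montgomery–Vaughan Thm. 13.1 / §15.1).
[cite: Koch1901, main theorem (ψ form)] -/
@[summit_bridge "RiemannHypothesis.RiemannHypothesis"]
theorem vonKochPsiBound_iff_riemannHypothesis :
    VonKochPsiBound ↔ _root_.RiemannHypothesis :=
  Iff.symm riemannHypothesis_iff_chebyshevPsi_isBigO_holds

/-- **Speiser's criterion** (landed: `speiser_iff_holds`, `RHClassicalEquivalentsSpeiserProofs`; Speiser 1934,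
Levinson–Montgomery 1974 Thm. 1). [cite: Speiser1934, Satz (via LevinsonMontgomery1974 Thm 1)] -/
@[summit_bridge "RiemannHypothesis.RiemannHypothesis"]
theorem speiserCondition_iff_riemannHypothesis :
    SpeiserCondition ↔ _root_.RiemannHypothesis :=
  Iff.symm speiser_iff_holds

/-- **Li's criterion** (landed: `li_criterion_holds`, `EquivalentsKeiperLiProofs`; Li 1997 Thm. 1).
[cite: Li1997, Thm. 1] -/
@[summit_bridge "RiemannHypothesis.RiemannHypothesis"]
theorem liPositivity_iff_riemannHypothesis :
    LiPositivity ↔ _root_.RiemannHypothesis :=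
  Iff.symm li_criterion_holds

/-- **Nyman–Beurling–Báez-Duarte criterion, `L²` form** (landed: `baezDuarte_iff_holds`,
`NymanBeurlingBaezDuarteProofs`; Báez-Duarte 2003 Thm. 1.1). [cite: BaezDuarte2003, Thm. 1.1] -/
@[summit_bridge "RiemannHypothesis.RiemannHypothesis"]
theorem baezDuarteClosure_iff_riemannHypothesis :
    BaezDuarteClosure ↔ _root_.RiemannHypothesis :=
  Iff.symm baezDuarte_iff_holds

/-- **Báez-Duarte criterion, Dirichlet-polynomial form** (landed: `baezDuarte_dirichlet_iff_holds`,
`RHClassicalEquivalentsProofs`; Báez-Duarte 2003 Thm. 1.1, BDBLS 2000 §1). [cite: BaezDuarte2003, Thm. 1.1] -/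
@[summit_bridge "RiemannHypothesis.RiemannHypothesis"]
theorem baezDuarteDirichletApprox_iff_riemannHypothesis :
    BaezDuarteDirichletApprox ↔ _root_.RiemannHypothesis :=
  Iff.symm baezDuarte_dirichlet_iff_holds

/-- **Katkova's total-positivity criterion** (landed: `riemannHypothesis_iff_isPolyaFrequencySeq_xi`,
`XiMultiplePositivityProofs`; Katkova 2006 §1 Thm. C). [cite: Katkova2006, §1 Thm. C] -/
@[summit_bridge "RiemannHypothesis.RiemannHypothesis"]
theorem xiTaylorPolyaFrequency_iff_riemannHypothesis :
    XiTaylorPolyaFrequency ↔ _root_.RiemannHypothesis :=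
  riemannHypothesis_iff_isPolyaFrequencySeq_xi.symm

/-- **Weil's criterion** (landed: `weil_criterion_holds`, `WeilCriterionProofs`; Weil 1952, Bombieri 2000 Thm. 2).
[cite: Bombieri2000, Thm. 2] -/
@[summit_bridge "RiemannHypothesis.RiemannHypothesis"]
theorem weilPositivity_iff_riemannHypothesis :
    WeilPositivity ↔ _root_.RiemannHypothesis :=
  Iff.symm weil_criterion_holds

/-- **Yoshida's fixed-support form of Weil's criterion** (landed: `uniformWeilPositivity_iff` fed with
`weil_criterion_holds`; Yoshida 1992, Bombieri 2000 §4). [cite: Bombieri2000, Thm. 2 and §4] -/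
@[summit_bridge "RiemannHypothesis.RiemannHypothesis"]
theorem uniformWeilPositivity_iff_riemannHypothesis :
    UniformWeilPositivity ↔ _root_.RiemannHypothesis :=
  uniformWeilPositivity_iff weil_criterion_holds

/-- **Pólya's Jensen-polynomial criterion** (landed: `polya_jensen_holds`, `JensenPolyaProofs`; Pólya 1927,
Griffin–Ono–Rolen–Zagier 2019 §1). [cite: GORZPNAS2019, §1] -/
@[summit_bridge "RiemannHypothesis.RiemannHypothesis"]
theorem jensenPolyaCriterion_iff_riemannHypothesis :
    JensenPolyaCriterion ↔ _root_.RiemannHypothesis :=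
  Iff.symm polya_jensen_holds

/-! ## Sanity: the bridges reach the summit `def` itself (definitional) -/

/-- Every bridge above concludes Mathlib's `RiemannHypothesis`, which IS the summit statement
`Summit.RiemannHypothesis` (`Summit.RiemannHypothesis_iff`, `Iff.rfl`); e.g. GRH gives the summit. [folklore] -/
theorem generalizedRiemannHypothesis_implies_summit :
    GeneralizedRiemannHypothesis → Summit.RiemannHypothesis :=
  fun h ↦ Summit.RiemannHypothesis_iff.mpr h.riemannHypothesis

end Summit.RiemannHypothesis.StrongHypotheses

end
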